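import Summits.QuantumFields.BalabanUV.T4Continuum.Support.NE9LevelCountsWindow

/-!
# NE9LevelCountsRecordFive — the species LEVEL COUNTS `LevelCountsG` ([II] (1.26)–(1.28) p. 8; the row owner's binder
# structure, `NE9Lemma1Gain`) on the carriers of record `B13Carriers.TwoRuns.carriers` with ALL FIVE FIELDS KERNEL modulo
# identification readings and letters: the assembly of «LC-REC» (`NE9LevelCountsRecord` p215967: `sumX`, `count0`), «LC-127»
# (`NE9LevelCountsAnimal` p216359: `sumY`) and «LC-WINDOW» (`NE9LevelCountsWindow`: `cover`, `countQ`) — cell `pub-balaban`,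
# T4-DAG §2 node U3 / §6 NE9; rung (B)+1 on a FIXED finite T⁴; NE9 formalisation swarm, unit `b2b-balaban-t4-ne9-formalise-leaf-01`
# gen 8, own-initiative lineage item «LC-WINDOW» part 2, journal CLAIM l.11983; nothing of any import is modified

HONEST FRAMING (T4-DAG PAGE 1).  Rung (B)+1 = existence and uniqueness of the ε → 0 limit of gauge-invariant observables on a
FIXED finite torus T⁴ — NOT infinite volume, NOT a mass gap, NOT the Clay problem.  NE9 (`T4OutputRate.NE9` ∧ `FadingMemory`) is
a cell NEW ESTIMATE, NOT PRINTED and NOT discharged here («NE9 ⇐ the named binders»); spine 0/9; 0/18 skeleton leaves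
instantiated on Bałaban's objects (O-NE9-1).  HONEST DEPENDENCY (cell line, verbatim): continuum YM on T⁴ ⇐ BetaPertH ∧ nine spine
estimates (0/9 proved); BetaPertH ⇐ (D1) ∧ (D4) ∧ CAP+tail; G-an2-4 gates asym, D1 and NE2/3/4.  `FlowStep.BetaPertH`, (B), (B^μ)
do not occur.  [II] = [Balaban1988RG2Cluster] (CMP **116**) is quoted for TYPES only (ABSOLUTE RULE: nothing printed in the
audited series is asserted).

WHAT.  `levelCountsG_of_record₅`: the owner's `LevelCountsG P κ κ₁ (m·(2²⁰+1)) c_Q gain ℓ′` for ANY piece frame `P` over ANY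
carriers READ on the carriers of record — (1.26) `sumX` at κ ≥ 144 (leaf-05-g4's block chain), (1.28) `count0` at κ₁ ≥ 69
(NE5-P2's volume bound), (1.27) `sumY` (relative lattice animals on the torus, κ₁ ≥ 25 ≤ 69), the □′-cover and the □′-count
(window reading + nesting of the partitions) — DISPLAYED: only the identification readings (LC-REC's `rd`/`hd`/`hm` with the
counting cube read as `⟨j, rq …⟩` and its fibre reading `hSX` ⊆ *"X ∈ 𝐃_j, X ⊃ □′"*, `Yout`/`hS0`/`hdY`; LC-127's `Anc`/`dom`/
`hinjY`/`hdom`/`hAnc`/`hvol`; LC-WINDOW's `W`/`hW`/`rq`/`hinj`/`hrq`/`hsrc`/`hsurj`/`hSXsup`) and the three letter binders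
`hgain`/`hcQℓ`/`hletters`; `levelCountsG_of_record₅_agePow`: the same in the species END's letters `gain = (agePow θ)⁵`,
`τ = c_Q·agePow ω` (the shape of the `hLa` socket of `NE9Lemma1SpeciesEnd.termSize_ne9_and_fadingMemory_species_compProj` with
`ℓg := agePow θ`) with the letter binders DISCHARGED from `0 ≤ θ`, `L⁴·θ⁵ ≤ ω`, `w ≤ c_Q` (print: θ = L⁻¹, ω = L^{−α}, α ≤ 1,
c_Q = w = (6L)⁴).  The readings of a species frame on Bałaban's (1.33) objects — which domains, which window □̃₀², which anchor
□̃⁴ — are O-NE9-1 and are NOT decided here.  DISGUISE TEST: two `exact`-level compositions BY NAME; no estimate of the series.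
Value = bookkeeping: the counting side of every species END is kernel on the cell's torus model modulo identifications, NOT
summit progress.

References (TYPES only): T. Bałaban, *Renormalization group approach to lattice gauge field theories. II. Cluster expansions*,
Commun. Math. Phys. **116** (1988) 1–22 [Balaban1988RG2Cluster], (1.26)–(1.28) p. 8, (2.30) p. 18.  Summits-side NEW work (LEAN
PLACEMENT RULE); imports «LC-WINDOW» `NE9LevelCountsWindow` (this lineage) ONLY (hence LC-REC, LC-127); modifies nothing; 0 `def`,
0 `def … : Prop`, 0 sorry; axioms ⊆ {propext, Classical.choice, Quot.sound}.
-/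

noncomputable section

open scoped BigOperators

namespace Summit.QuantumFields.BalabanUV.T4Continuum.NE9LevelCountsRecordFive

open Literature.MathematicalPhysics.QuantumFieldTheory.Balaban1983to89
open Literature.MathematicalPhysics.QuantumFieldTheory.Balaban1983to89.T4OutputRate (Carriers)
open Literature.MathematicalPhysics.QuantumFieldTheory.Balaban1983to89.TreeLengthTorus (TPt TFaceConnected TDom)
open Summit.QuantumFields.BalabanUV.T4Continuum.B13Carriers (TwoRuns)
open Summit.QuantumFields.BalabanUV.T4Continuum.B13DomainGeometryTR
open Summit.QuantumFields.BalabanUV.T4Continuum.B13InnerData (coarsen)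
open Summit.QuantumFields.BalabanUV.T4Continuum.NE9Lemma1Counting
open Summit.QuantumFields.BalabanUV.T4Continuum.NE9Lemma1Gain
open Summit.QuantumFields.BalabanUV.T4Continuum.NE9LevelCountsAnimal (levelCountsG_of_record₃)
open Summit.QuantumFields.BalabanUV.T4Continuum.NE9LevelCountsWindow (cover_of_window countQ_of_window countQ_of_window_agePow)

section Record

variable {G : Type} [GaugeGroup G] (R : TwoRuns G)
variable {C : Carriers} {Bg ι α β γ : Type}

/-! ## The structure assembled: all five fields kernel on the carriers of record -/

/-- **THE SPECIES LEVEL COUNTS ON THE CARRIERS OF RECORD — ALL FIVE FIELDS KERNEL** modulo identification readings and letters: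
«LC-REC»'s (1.26) `sumX` (κ ≥ 144, O1 := m·(2²⁰+1), leaf-05-g4's block chain) and (1.28) `count0` (κ₁ ≥ 69, NE5-P2's volume
bound), «LC-127»'s (1.27) `sumY` (relative lattice animals on the torus), and this file's □′-cover `cover` and □′-count `countQ`
(window reading + nesting of the partitions + ONE letter inequality).  DISPLAYED: the readings — LC-REC's `rd`/`hd`/`hm` with the
counting cube read as `⟨j, rq …⟩`, its fibre reading `hSX` (*"X ∈ 𝐃_j, X ⊃ □′"*, ⊆) and this file's `hSXsup` (⊇ the sources
through □′), `Yout`/`hS0`/`hdY`; LC-127's `Anc`/`dom`/`hinjY`/`hdom`/`hAnc`/`hvol`; the window `W`/`hW`/`rq`/`hinj`/`hrq`/`hsrc`/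
`hsurj` — and the letters `hgain`/`hcQℓ`/`hletters` (discharged in the END's letters by `countQ_of_window_agePow` /
`levelCountsG_of_record₅_agePow`).  Conclusion LITERALLY the owner's `LevelCountsG P κ κ₁ (m·(2²⁰+1)) c_Q gain ℓ′`.
[cite: Balaban1988RG2Cluster, (1.26)-(1.28) p.8, (2.30) p.18] -/
theorem levelCountsG_of_record₅ (P : PieceData C Bg ι α β γ) {κ κ₁ cQ : ℝ} {gain ℓ' : ℕ → ℕ → ℝ}
    -- LC-REC's readings, the counting cube read as ⟨j, rq …⟩
    (rd : C.Dom → R.carriers.Dom) (hd : ∀ x, C.d x = R.carriers.d (rd x)) {m : ℕ}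
    (hm : ∀ (k : ℕ) (y : ι) (a : α) (j : ℕ) (q : γ) (Y : R.carriers.Dom),
      ((((P.SX k y a j q).filter fun x => rd x = Y).card : ℕ) : ℝ) ≤ m)
    (rq : (k : ℕ) → ι → α → (j : ℕ) → γ → TPt 4 (R.cubesPerDir j))
    (hSX : ∀ (k : ℕ) (y : ι) (a : α) (j : ℕ) (q : γ), ∀ x ∈ P.SX k y a j q,
      rd x ∈ R.domAt j ∧ (⟨j, rq k y a j q⟩ : SCube R) ∈ footprint (rd x))
    (hκ : 144 ≤ κ)
    (Yout : ℕ → ι → R.carriers.Dom)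
    (hS0 : ∀ (k : ℕ) (y : ι), (P.S0 k y).card ≤ (footprint (Yout k y)).card)
    (hdY : ∀ (k : ℕ) (y : ι), 1 + R.carriers.d (Yout k y) ≤ P.dY k y) (hκ₁ : 69 ≤ κ₁)
    -- LC-127's readings: (1.27) side
    (Anc : (k : ℕ) → ι → α → Finset (TPt 4 (R.cubesPerDir k)))
    (dom : (k : ℕ) → ι → α → β → Finset (TPt 4 (R.cubesPerDir k)))
    (hinjY : ∀ (k : ℕ) (y : ι) (a : α), Set.InjOn (dom k y a) ↑(P.SY k y a))
    (hdom : ∀ (k : ℕ) (y : ι) (a : α), ∀ b ∈ P.SY k y a,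
      Anc k y a ⊆ dom k y a b ∧ (dom k y a b).Nonempty ∧ TFaceConnected (dom k y a b))
    (hAnc : ∀ (k : ℕ) (y : ι) (a : α), (Anc k y a).Nonempty ∧ (Anc k y a).card ≤ 6561)
    (hvol : ∀ (k : ℕ) (y : ι) (a : α), ∀ b ∈ P.SY k y a, P.vol k y a b = ((dom k y a b \ Anc k y a).card : ℝ))
    -- this file's readings: the window
    (W : (k : ℕ) → ι → α → Finset (TPt 4 (R.cubesPerDir k))) {w : ℝ}
    (hW : ∀ (k : ℕ) (y : ι) (a : α), ((W k y a).card : ℝ) ≤ w)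
    (hinj : ∀ (k : ℕ) (y : ι) (a : α) (j : ℕ), Set.InjOn (rq k y a j) ↑(P.Sq k y a j))
    (hrq : ∀ (k : ℕ) (y : ι) (a : α) (j : ℕ), ∀ q ∈ P.Sq k y a j,
      j ≤ k ∧ k + R.m' ≤ R.F.m + R.K ∧ coarsen R j k (rq k y a j q) ∈ W k y a)
    (hsrc : ∀ (k : ℕ) (y : ι) (a : α) (j : ℕ), ∀ x ∈ P.src k y a j,
      j ≤ k ∧ k + R.m' ≤ R.F.m + R.K ∧ rd x ∈ R.domAt j ∧ ∀ c ∈ footprint (rd x), coarsen R c.1 k c.2 ∈ W k y a)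
    (hsurj : ∀ (k : ℕ) (y : ι) (a : α) (j : ℕ), j ≤ k → k + R.m' ≤ R.F.m + R.K →
      ∀ b : TPt 4 (R.cubesPerDir j), coarsen R j k b ∈ W k y a → ∃ q ∈ P.Sq k y a j, rq k y a j q = b)
    (hSXsup : ∀ (k : ℕ) (y : ι) (a : α) (j : ℕ), ∀ q ∈ P.Sq k y a j, ∀ x ∈ P.src k y a j,
      (⟨j, rq k y a j q⟩ : SCube R) ∈ footprint (rd x) → x ∈ P.SX k y a j q)
    -- the letters
    (hgain : ∀ k j, 0 ≤ gain k j) (hcQℓ : ∀ k j, 0 ≤ cQ * ℓ' k j)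
    (hletters : ∀ k j, j ≤ k → w * ((R.F.L : ℝ) ^ 4) ^ (k - j) * gain k j ≤ cQ * ℓ' k j) :
    LevelCountsG P κ κ₁ ((m : ℝ) * (2 ^ 20 + 1)) cQ gain ℓ' :=
  levelCountsG_of_record₃ R P rd hd hm (fun k y a j q => ⟨j, rq k y a j q⟩) hSX hκ Yout hS0 hdY hκ₁ Anc dom hinjY hdom
    hAnc hvol (cover_of_window R P rd W rq hsrc hsurj hSXsup) (countQ_of_window R P W hW rq hinj hrq hgain hcQℓ hletters)

/-- **COROLLARY IN THE SPECIES END's LETTERS** (`gain = (agePow θ)⁵`, `τ = c_Q·agePow ω` — the shape of the `hLa` socket of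
`NE9Lemma1SpeciesEnd.termSize_ne9_and_fadingMemory_species_compProj` with `ℓg := agePow θ`): the three letter binders of
`levelCountsG_of_record₅` DISCHARGED from `0 ≤ θ`, `L⁴·θ⁵ ≤ ω`, `w ≤ c_Q`. [cite: Balaban1988RG2Cluster, (1.26)-(1.28) p.8] -/
theorem levelCountsG_of_record₅_agePow (P : PieceData C Bg ι α β γ) {κ κ₁ cQ θ ω : ℝ}
    (rd : C.Dom → R.carriers.Dom) (hd : ∀ x, C.d x = R.carriers.d (rd x)) {m : ℕ}
    (hm : ∀ (k : ℕ) (y : ι) (a : α) (j : ℕ) (q : γ) (Y : R.carriers.Dom),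
      ((((P.SX k y a j q).filter fun x => rd x = Y).card : ℕ) : ℝ) ≤ m)
    (rq : (k : ℕ) → ι → α → (j : ℕ) → γ → TPt 4 (R.cubesPerDir j))
    (hSX : ∀ (k : ℕ) (y : ι) (a : α) (j : ℕ) (q : γ), ∀ x ∈ P.SX k y a j q,
      rd x ∈ R.domAt j ∧ (⟨j, rq k y a j q⟩ : SCube R) ∈ footprint (rd x))
    (hκ : 144 ≤ κ)
    (Yout : ℕ → ι → R.carriers.Dom)
    (hS0 : ∀ (k : ℕ) (y : ι), (P.S0 k y).card ≤ (footprint (Yout k y)).card)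
    (hdY : ∀ (k : ℕ) (y : ι), 1 + R.carriers.d (Yout k y) ≤ P.dY k y) (hκ₁ : 69 ≤ κ₁)
    (Anc : (k : ℕ) → ι → α → Finset (TPt 4 (R.cubesPerDir k)))
    (dom : (k : ℕ) → ι → α → β → Finset (TPt 4 (R.cubesPerDir k)))
    (hinjY : ∀ (k : ℕ) (y : ι) (a : α), Set.InjOn (dom k y a) ↑(P.SY k y a))
    (hdom : ∀ (k : ℕ) (y : ι) (a : α), ∀ b ∈ P.SY k y a,
      Anc k y a ⊆ dom k y a b ∧ (dom k y a b).Nonempty ∧ TFaceConnected (dom k y a b))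
    (hAnc : ∀ (k : ℕ) (y : ι) (a : α), (Anc k y a).Nonempty ∧ (Anc k y a).card ≤ 6561)
    (hvol : ∀ (k : ℕ) (y : ι) (a : α), ∀ b ∈ P.SY k y a, P.vol k y a b = ((dom k y a b \ Anc k y a).card : ℝ))
    (W : (k : ℕ) → ι → α → Finset (TPt 4 (R.cubesPerDir k))) {w : ℝ}
    (hW : ∀ (k : ℕ) (y : ι) (a : α), ((W k y a).card : ℝ) ≤ w)
    (hinj : ∀ (k : ℕ) (y : ι) (a : α) (j : ℕ), Set.InjOn (rq k y a j) ↑(P.Sq k y a j))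
    (hrq : ∀ (k : ℕ) (y : ι) (a : α) (j : ℕ), ∀ q ∈ P.Sq k y a j,
      j ≤ k ∧ k + R.m' ≤ R.F.m + R.K ∧ coarsen R j k (rq k y a j q) ∈ W k y a)
    (hsrc : ∀ (k : ℕ) (y : ι) (a : α) (j : ℕ), ∀ x ∈ P.src k y a j,
      j ≤ k ∧ k + R.m' ≤ R.F.m + R.K ∧ rd x ∈ R.domAt j ∧ ∀ c ∈ footprint (rd x), coarsen R c.1 k c.2 ∈ W k y a)
    (hsurj : ∀ (k : ℕ) (y : ι) (a : α) (j : ℕ), j ≤ k → k + R.m' ≤ R.F.m + R.K →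
      ∀ b : TPt 4 (R.cubesPerDir j), coarsen R j k b ∈ W k y a → ∃ q ∈ P.Sq k y a j, rq k y a j q = b)
    (hSXsup : ∀ (k : ℕ) (y : ι) (a : α) (j : ℕ), ∀ q ∈ P.Sq k y a j, ∀ x ∈ P.src k y a j,
      (⟨j, rq k y a j q⟩ : SCube R) ∈ footprint (rd x) → x ∈ P.SX k y a j q)
    (hθ : 0 ≤ θ) (hper : (R.F.L : ℝ) ^ 4 * θ ^ 5 ≤ ω) (hw : w ≤ cQ) :
    LevelCountsG P κ κ₁ ((m : ℝ) * (2 ^ 20 + 1)) cQ (fun k j => (agePow θ k j) ^ 5) (agePow ω) :=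
  levelCountsG_of_record₃ R P rd hd hm (fun k y a j q => ⟨j, rq k y a j q⟩) hSX hκ Yout hS0 hdY hκ₁ Anc dom hinjY hdom
    hAnc hvol (cover_of_window R P rd W rq hsrc hsurj hSXsup) (countQ_of_window_agePow R P W hW rq hinj hrq hθ hper hw)

end Record

end Summit.QuantumFields.BalabanUV.T4Continuum.NE9LevelCountsRecordFive

end
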